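import Summits.Ventures.Crystal3D.Theorems.StickyWulffConstantNoReconstructionGainWindowBarlowFilm
import Summits.Ventures.Crystal3D.Theorems.StickyWulffConstantNoReconstructionGainSymmetryOrbit
import HarnessLib

/-!
# Barlow films of ANY `{111}` family in the window beyond its `54.7°` cone: the atom, by lattice symmetry

HONEST FRAMING. Part of the venture `Summits/Ventures/Crystal3D` (cell `crystal3d-full`), helper
`--supports` the crux `NoReconstructionGain` (stmt-Ventures-19144, route
`route-Ventures-StickyWulffConstant`), line `adhesion`; continuation of `…WindowBarlowFilm`
(`windowBarlowFilm_adhesion`: films inside `B = Λ₀ ∪ (Λ₀ + w) ∪ (Λ₀ − w)`, normals in the WINDOW: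
exactly one of `|⟪w,ν⟫|, |⟪w−u,ν⟫|, |⟪w−v,ν⟫|` below `√(2/3)|ν₃|`, two above) and of
`…BasalBarlowFilmOrbit` (the same transport for the basal regime).  Transport by a linear isometry `g`
mapping `Λ₀` onto itself:

* `windowCut_cross_le` — the SUBSTRATE-FREE form: in a finite unit packing of basal Barlow positions,
  every `ν`-monotone cut with `ν` in the window has `#cross(P, X \ P) ≤ D(X \ P)`;
* `windowBarlowFilm_adhesion_orbit` (**the rung**, `R = 1`, `C = 0`; registered by name): for every
  lattice symmetry `g`, every unit `ν` in the window of the family `g e₃` (the three hollow values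
  `⟪g w, ν⟫, ⟪g (w − u), ν⟫, ⟪g (w − v), ν⟫` against `√(2/3)|⟪ν, g e₃⟫|`), every `ρ ≥ 1`, and every finite
  unit packing `X ⊇ P` around the `ν`-slab sample whose film lies in
  `g B = Λ₀ ∪ (Λ₀ + g w) ∪ (Λ₀ − g w)` and above the cut: `#cross(P, X \ P) ≤ contactDeficiency (X \ P)`.

Together with `basalBarlowFilm_adhesion_orbit` this certifies, at a given normal `ν`, every
single-family Barlow film of each `{111}` family whose axis sees `ν` in basal ∪ window position —
`70.5 %` of directions per family instead of `43.9 %`.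

WHAT THIS IS NOT: the residual `29.5 %` per family; films mixing families; rung F-C1 not moved.
-/

noncomputable section

namespace Summit.Ventures.Crystal3D.Theorems

open Summit.Ventures.Crystal3D Finset
open Literature.MathematicalPhysics.StatisticalMechanics (barlowPos fccStacking barlowOffset layerNormal constHagg
  orderedContacts contactDeficiency)
open scoped InnerProductSpace

/-- **Substrate-free form: a `ν`-monotone cut of a basal Barlow-position packing never gains, window
regime.**  For every `ν` in the window, every finite unit packing `X` of basal Barlow positions and
every `P ⊆ X` such that every contact between `P` and `X \ P` goes `ν`-upward:
`#cross(P, X \ P) ≤ contactDeficiency (X \ P)`. -/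
theorem windowCut_cross_le (ν : EuclideanSpace ℝ (Fin 3))
    (hwin : (|⟪barlowOffset 1, ν⟫_ℝ| < Real.sqrt (2 / 3) * |ν 2| ∧
          Real.sqrt (2 / 3) * |ν 2| < |⟪barlowOffset 1 - barlowPos 1 (Real.sqrt (2 / 3)) constHagg 0 1 0, ν⟫_ℝ| ∧
          Real.sqrt (2 / 3) * |ν 2| < |⟪barlowOffset 1 - barlowPos 1 (Real.sqrt (2 / 3)) constHagg 0 0 1, ν⟫_ℝ|) ∨
        (|⟪barlowOffset 1 - barlowPos 1 (Real.sqrt (2 / 3)) constHagg 0 1 0, ν⟫_ℝ| < Real.sqrt (2 / 3) * |ν 2| ∧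
          Real.sqrt (2 / 3) * |ν 2| < |⟪barlowOffset 1, ν⟫_ℝ| ∧
          Real.sqrt (2 / 3) * |ν 2| < |⟪barlowOffset 1 - barlowPos 1 (Real.sqrt (2 / 3)) constHagg 0 0 1, ν⟫_ℝ|) ∨
        (|⟪barlowOffset 1 - barlowPos 1 (Real.sqrt (2 / 3)) constHagg 0 0 1, ν⟫_ℝ| < Real.sqrt (2 / 3) * |ν 2| ∧
          Real.sqrt (2 / 3) * |ν 2| < |⟪barlowOffset 1, ν⟫_ℝ| ∧
          Real.sqrt (2 / 3) * |ν 2| < |⟪barlowOffset 1 - barlowPos 1 (Real.sqrt (2 / 3)) constHagg 0 1 0, ν⟫_ℝ|))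
    (X P : Finset (EuclideanSpace ℝ (Fin 3)))
    (hX : ∀ p ∈ X, ∀ q ∈ X, p ≠ q → 1 ≤ dist p q) (hPX : P ⊆ X)
    (hB : ∀ y ∈ X, y ∈ fccStacking 1 (Real.sqrt (2 / 3)) ∨
      y - barlowOffset 1 ∈ fccStacking 1 (Real.sqrt (2 / 3)) ∨
      y + barlowOffset 1 ∈ fccStacking 1 (Real.sqrt (2 / 3)))
    (hup : ∀ p ∈ P, ∀ q ∈ X \ P, dist q p = 1 → ⟪p, ν⟫_ℝ < ⟪q, ν⟫_ℝ) :
    ((((P ×ˢ (X \ P)).filter fun pq => dist pq.1 pq.2 = 1).card : ℕ) : ℝ) ≤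
      contactDeficiency (X \ P) := by
  classical
  set w : EuclideanSpace ℝ (Fin 3) := barlowOffset 1 with hw
  set wu : EuclideanSpace ℝ (Fin 3) := barlowOffset 1 - barlowPos 1 (Real.sqrt (2 / 3)) constHagg 0 1 0 with hwu
  set wv : EuclideanSpace ℝ (Fin 3) := barlowOffset 1 - barlowPos 1 (Real.sqrt (2 / 3)) constHagg 0 0 1 with hwv
  have hnw : ‖w‖ ^ 2 = 1 / 3 := norm_sq_barlowOffset'
  have hnwu : ‖wu‖ ^ 2 = 1 / 3 := norm_sq_barlowOffset_sub_u
  have hnwv : ‖wv‖ ^ 2 = 1 / 3 := norm_sq_barlowOffset_sub_v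
  have hsum : w + wu + wv = 0 := hollow_triple_sum
  obtain ⟨N', hN', hN'ν⟩ : ∃ N' : EuclideanSpace ℝ (Fin 3),
      (N' = layerNormal (Real.sqrt (2 / 3)) ∨ N' = -layerNormal (Real.sqrt (2 / 3))) ∧
      ⟪N', ν⟫_ℝ = Real.sqrt (2 / 3) * |ν 2| := by
    rcases le_or_gt 0 (ν 2) with h | h
    · exact ⟨_, Or.inl rfl, by rw [inner_layerNormal_left, abs_of_nonneg h]⟩
    · exact ⟨_, Or.inr rfl, by rw [inner_neg_left, inner_layerNormal_left, abs_of_neg h]; ring⟩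
  set f : EuclideanSpace ℝ (Fin 3) → ℝ := fun y => ⟪y, ν⟫_ℝ with hf
  set Φ : EuclideanSpace ℝ (Fin 3) → ℤ := fun x => (((X \ P).filter fun y => f y < f x).card : ℤ) with hΦ
  have hmain := cross_le_of_potential X P ∅ hX hPX (empty_subset _) Φ fun q hq => by
    rw [sdiff_empty] at hq
    have hlt : ∀ x ∈ X \ P, dist q x = 1 → (Φ x < Φ q ↔ ⟪x, ν⟫_ℝ < ⟪q, ν⟫_ℝ) := fun x hx _ => by
      simp only [hΦ]; exact rank_lt_iff (X \ P) f x q hx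
    have heq : ∀ x ∈ X \ P, dist q x = 1 → (Φ x = Φ q ↔ ⟪x, ν⟫_ℝ = ⟪q, ν⟫_ℝ) := fun x hx _ => by
      simp only [hΦ]; exact rank_eq_iff (X \ P) f x q hx hq
    have hplug : ∀ p ∈ P, dist q p = 1 → ⟪p, ν⟫_ℝ < ⟪q, ν⟫_ℝ := fun p hp hd => hup p hp q hq hd
    have hdir := fun x hx hd => basal_unit_vectors (hB q (mem_sdiff.1 hq).1) (hB x hx) hd
    rw [← hN'ν] at hwin
    rcases hwin with ⟨h0, h1, h2⟩ | ⟨h0, h1, h2⟩ | ⟨h0, h1, h2⟩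
    · exact window_noGainPotential X P hX hPX q Φ ν N' w wu wv hN'
        (fun τ hτ => by simp only [List.mem_cons, List.mem_nil_iff, or_false] at hτ; tauto)
        hnw hnwu hnwv hsum h0 h1 h2 hlt heq hplug hdir
    · exact window_noGainPotential X P hX hPX q Φ ν N' wu w wv hN'
        (fun τ hτ => by simp only [List.mem_cons, List.mem_nil_iff, or_false] at hτ; tauto)
        hnwu hnw hnwv (by rw [← hsum]; abel) h0 h1 h2 hlt heq hplug hdir
    · exact window_noGainPotential X P hX hPX q Φ ν N' wv w wu hN'
        (fun τ hτ => by simp only [List.mem_cons, List.mem_nil_iff, or_false] at hτ; tauto)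
        hnwv hnw hnwu (by rw [← hsum]; abel) h0 h1 h2 hlt heq hplug hdir
  simpa using hmain

/-- **Barlow films of the `{111}` family `g e₃` at normals in that family's window: the atom**
(`R = 1`, `C = 0`; registered by name on stmt-Ventures-19144). -/
theorem windowBarlowFilm_adhesion_orbit :
    ∃ R C : ℝ, 1 ≤ R ∧ ∀ ν : EuclideanSpace ℝ (Fin 3), ‖ν‖ = 1 → ∀ ρ : ℝ, R ≤ ρ →
      ∀ X P : Finset (EuclideanSpace ℝ (Fin 3)),
      (∀ p ∈ X, ∀ q ∈ X, p ≠ q → 1 ≤ dist p q) → P ⊆ X →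
      (∀ p, p ∈ P ↔ (p ∈ fccStacking 1 (Real.sqrt (2 / 3)) ∧ -(2 * R) ≤ ⟪p, ν⟫_ℝ ∧
        ⟪p, ν⟫_ℝ ≤ -R ∧ ‖p‖ ^ 2 - ⟪p, ν⟫_ℝ ^ 2 ≤ ρ ^ 2)) →
      ∀ g : EuclideanSpace ℝ (Fin 3) ≃ₗᵢ[ℝ] EuclideanSpace ℝ (Fin 3),
      (∀ p ∈ fccStacking 1 (Real.sqrt (2 / 3)), g p ∈ fccStacking 1 (Real.sqrt (2 / 3))) →
      (∀ p ∈ fccStacking 1 (Real.sqrt (2 / 3)), g.symm p ∈ fccStacking 1 (Real.sqrt (2 / 3))) →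
      ((|⟪g (barlowOffset 1), ν⟫_ℝ| < Real.sqrt (2 / 3) * |⟪ν, g (EuclideanSpace.single (2 : Fin 3) (1 : ℝ))⟫_ℝ| ∧
          Real.sqrt (2 / 3) * |⟪ν, g (EuclideanSpace.single (2 : Fin 3) (1 : ℝ))⟫_ℝ| <
            |⟪g (barlowOffset 1 - barlowPos 1 (Real.sqrt (2 / 3)) constHagg 0 1 0), ν⟫_ℝ| ∧
          Real.sqrt (2 / 3) * |⟪ν, g (EuclideanSpace.single (2 : Fin 3) (1 : ℝ))⟫_ℝ| <
            |⟪g (barlowOffset 1 - barlowPos 1 (Real.sqrt (2 / 3)) constHagg 0 0 1), ν⟫_ℝ|) ∨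
        (|⟪g (barlowOffset 1 - barlowPos 1 (Real.sqrt (2 / 3)) constHagg 0 1 0), ν⟫_ℝ| <
            Real.sqrt (2 / 3) * |⟪ν, g (EuclideanSpace.single (2 : Fin 3) (1 : ℝ))⟫_ℝ| ∧
          Real.sqrt (2 / 3) * |⟪ν, g (EuclideanSpace.single (2 : Fin 3) (1 : ℝ))⟫_ℝ| < |⟪g (barlowOffset 1), ν⟫_ℝ| ∧
          Real.sqrt (2 / 3) * |⟪ν, g (EuclideanSpace.single (2 : Fin 3) (1 : ℝ))⟫_ℝ| <
            |⟪g (barlowOffset 1 - barlowPos 1 (Real.sqrt (2 / 3)) constHagg 0 0 1), ν⟫_ℝ|) ∨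
        (|⟪g (barlowOffset 1 - barlowPos 1 (Real.sqrt (2 / 3)) constHagg 0 0 1), ν⟫_ℝ| <
            Real.sqrt (2 / 3) * |⟪ν, g (EuclideanSpace.single (2 : Fin 3) (1 : ℝ))⟫_ℝ| ∧
          Real.sqrt (2 / 3) * |⟪ν, g (EuclideanSpace.single (2 : Fin 3) (1 : ℝ))⟫_ℝ| < |⟪g (barlowOffset 1), ν⟫_ℝ| ∧
          Real.sqrt (2 / 3) * |⟪ν, g (EuclideanSpace.single (2 : Fin 3) (1 : ℝ))⟫_ℝ| <
            |⟪g (barlowOffset 1 - barlowPos 1 (Real.sqrt (2 / 3)) constHagg 0 1 0), ν⟫_ℝ|)) →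
      (∀ q ∈ X \ P, q ∈ fccStacking 1 (Real.sqrt (2 / 3)) ∨
        q - g (barlowOffset 1) ∈ fccStacking 1 (Real.sqrt (2 / 3)) ∨
        q + g (barlowOffset 1) ∈ fccStacking 1 (Real.sqrt (2 / 3))) →
      (∀ q ∈ X \ P, -R < ⟪q, ν⟫_ℝ) →
      ((((P ×ˢ (X \ P)).filter fun pq => dist pq.1 pq.2 = 1).card : ℕ) : ℝ) ≤
        contactDeficiency (X \ P) + C * ρ := by
  classical
  obtain ⟨R, C, hR, h⟩ := windowBarlowFilm_adhesion
  refine ⟨R, C, hR, fun ν hν ρ hρ X P hX hPX hP g hg hg' hwin hfilm habove => ?_⟩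
  -- pull back by `g⁻¹`
  have hgi : Isometry (g.symm : EuclideanSpace ℝ (Fin 3) → EuclideanSpace ℝ (Fin 3)) :=
    g.symm.isometry
  have hinj : Function.Injective (g.symm : EuclideanSpace ℝ (Fin 3) → EuclideanSpace ℝ (Fin 3)) :=
    g.symm.injective
  set X' := X.image g.symm with hX'
  set P' := P.image g.symm with hP'def
  set ν' := g.symm ν with hν'
  have hsd : X' \ P' = (X \ P).image g.symm := by
    rw [hX', hP'def, image_sdiff_of_injOn hinj.injOn hPX]
  have hXp : ∀ p ∈ X', ∀ q ∈ X', p ≠ q → 1 ≤ dist p q := by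
    intro p hp q hq hpq
    obtain ⟨p₀, hp₀, rfl⟩ := mem_image.1 hp
    obtain ⟨q₀, hq₀, rfl⟩ := mem_image.1 hq
    rw [hgi.dist_eq]
    exact hX p₀ hp₀ q₀ hq₀ fun e => hpq (by rw [e])
  have hPXp : P' ⊆ X' := image_subset_image hPX
  have hinn : ∀ p, ⟪g.symm p, ν'⟫_ℝ = ⟪p, ν⟫_ℝ := fun p => by
    rw [hν', LinearIsometryEquiv.inner_map_map]
  have hνn : ‖ν'‖ = 1 := by rw [hν', LinearIsometryEquiv.norm_map, hν]
  have hPp : ∀ p, p ∈ P' ↔ (p ∈ fccStacking 1 (Real.sqrt (2 / 3)) ∧ -(2 * R) ≤ ⟪p, ν'⟫_ℝ ∧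
      ⟪p, ν'⟫_ℝ ≤ -R ∧ ‖p‖ ^ 2 - ⟪p, ν'⟫_ℝ ^ 2 ≤ ρ ^ 2) := by
    intro p
    rw [hP'def, mem_image]
    constructor
    · rintro ⟨p₀, hp₀, rfl⟩
      obtain ⟨hΛ, h1, h2, h3⟩ := (hP p₀).1 hp₀
      refine ⟨hg' p₀ hΛ, ?_, ?_, ?_⟩
      · rw [hinn]; exact h1
      · rw [hinn]; exact h2
      · rw [hinn, LinearIsometryEquiv.norm_map]; exact h3
    · rintro ⟨hΛ, h1, h2, h3⟩
      have hi : ⟪g p, ν⟫_ℝ = ⟪p, ν'⟫_ℝ := by rw [← hinn (g p), LinearIsometryEquiv.symm_apply_apply]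
      refine ⟨g p, (hP (g p)).2 ⟨hg p hΛ, ?_, ?_, ?_⟩, g.symm_apply_apply p⟩
      · rw [hi]; exact h1
      · rw [hi]; exact h2
      · rw [hi, LinearIsometryEquiv.norm_map]; exact h3
  -- the transported window condition
  have e2 : ν' 2 = ⟪ν, g (EuclideanSpace.single (2 : Fin 3) (1 : ℝ))⟫_ℝ := by
    have : ⟪ν', EuclideanSpace.single (2 : Fin 3) (1 : ℝ)⟫_ℝ = ν' 2 := by
      simp [EuclideanSpace.inner_single_right]
    rw [← this, hν', ← g.inner_map_map, LinearIsometryEquiv.apply_symm_apply]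
  have et : ∀ τ : EuclideanSpace ℝ (Fin 3), ⟪τ, ν'⟫_ℝ = ⟪g τ, ν⟫_ℝ := fun τ => by
    rw [hν', ← g.inner_map_map, LinearIsometryEquiv.apply_symm_apply]
  have hwin' :
      (|⟪barlowOffset 1, ν'⟫_ℝ| < Real.sqrt (2 / 3) * |ν' 2| ∧
          Real.sqrt (2 / 3) * |ν' 2| < |⟪barlowOffset 1 - barlowPos 1 (Real.sqrt (2 / 3)) constHagg 0 1 0, ν'⟫_ℝ| ∧
          Real.sqrt (2 / 3) * |ν' 2| < |⟪barlowOffset 1 - barlowPos 1 (Real.sqrt (2 / 3)) constHagg 0 0 1, ν'⟫_ℝ|) ∨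
        (|⟪barlowOffset 1 - barlowPos 1 (Real.sqrt (2 / 3)) constHagg 0 1 0, ν'⟫_ℝ| < Real.sqrt (2 / 3) * |ν' 2| ∧
          Real.sqrt (2 / 3) * |ν' 2| < |⟪barlowOffset 1, ν'⟫_ℝ| ∧
          Real.sqrt (2 / 3) * |ν' 2| < |⟪barlowOffset 1 - barlowPos 1 (Real.sqrt (2 / 3)) constHagg 0 0 1, ν'⟫_ℝ|) ∨
        (|⟪barlowOffset 1 - barlowPos 1 (Real.sqrt (2 / 3)) constHagg 0 0 1, ν'⟫_ℝ| < Real.sqrt (2 / 3) * |ν' 2| ∧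
          Real.sqrt (2 / 3) * |ν' 2| < |⟪barlowOffset 1, ν'⟫_ℝ| ∧
          Real.sqrt (2 / 3) * |ν' 2| < |⟪barlowOffset 1 - barlowPos 1 (Real.sqrt (2 / 3)) constHagg 0 1 0, ν'⟫_ℝ|) := by
    simp only [et, e2]; exact hwin
  have hfilm' : ∀ q ∈ X' \ P', q ∈ fccStacking 1 (Real.sqrt (2 / 3)) ∨
      q - barlowOffset 1 ∈ fccStacking 1 (Real.sqrt (2 / 3)) ∨
      q + barlowOffset 1 ∈ fccStacking 1 (Real.sqrt (2 / 3)) := by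
    intro q hq
    rw [hsd] at hq
    obtain ⟨q₀, hq₀, rfl⟩ := mem_image.1 hq
    rcases hfilm q₀ hq₀ with h0 | h1 | h2
    · exact Or.inl (hg' q₀ h0)
    · refine Or.inr (Or.inl ?_)
      have : g.symm q₀ - barlowOffset 1 = g.symm (q₀ - g (barlowOffset 1)) := by
        rw [map_sub, LinearIsometryEquiv.symm_apply_apply]
      rw [this]; exact hg' _ h1
    · refine Or.inr (Or.inr ?_)
      have : g.symm q₀ + barlowOffset 1 = g.symm (q₀ + g (barlowOffset 1)) := by
        rw [map_add, LinearIsometryEquiv.symm_apply_apply]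
      rw [this]; exact hg' _ h2
  have habove' : ∀ q ∈ X' \ P', -R < ⟪q, ν'⟫_ℝ := by
    intro q hq
    rw [hsd] at hq
    obtain ⟨q₀, hq₀, rfl⟩ := mem_image.1 hq
    rw [hinn]; exact habove q₀ hq₀
  have hmain := h ν' hνn ρ hρ X' P' hXp hPXp hPp hwin' hfilm' habove'
  rw [hsd, hP'def, card_cross_image_of_isometry hgi, contactDeficiency_image_of_isometry hgi]
    at hmain
  exact hmain

end Summit.Ventures.Crystal3D.Theorems

end
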